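import Mathlib.NumberTheory.Padics.PadicIntegers
import Mathlib.NumberTheory.Padics.RingHoms
import Mathlib.RingTheory.AdjoinRoot
import Mathlib.RingTheory.Henselian
import Mathlib.RingTheory.Polynomial.Eisenstein.Basic
import Mathlib.RingTheory.Polynomial.GaussLemma
import Mathlib.RingTheory.Polynomial.RationalRoot
import Mathlib.RingTheory.DiscreteValuationRing.Basic
import Mathlib.LinearAlgebra.FiniteDimensional.Lemmas
import Mathlib.Tactic.ComputeDegree
import Literature.AlgebraicGeometry.Resolution.FiniteOverCompleteLocal
import HarnessLib

/-!
# The quartic Kummer field `K₄ = ℚ₃(ϖ)`, `ϖ⁴ = 3`, and Hensel's lemma in its order `ℤ₃[ϖ]`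
# (cell `b2b-bsdres`, team n1011, row T-SSQ3, seat n1011-p05 GEN 11, FILE F1 — class-free TOOL)

HONEST FRAMING (cell `b2b-bsdres`, run/shared/lean/b2b/bsd-rank1-residual/, verbatim in every
file): the goal of the cell is to DELETE the COMBINATION-SHAPED residual classes of the
Birch–Swinnerton-Dyer formula for ALL analytic-rank `≤ 1` elliptic curves over `ℚ` — "full BSD
formula for every rank `≤ 1` curve in class `C`" assembled STRICTLY from published theorems — so
that the rank-`≤ 1` remainder becomes exactly the CONSTRUCTION-SHAPED classes, which are TYPED
(missing-input `Prop`s), NOT attempted. This is not "finishing BSD". Team n1011; row T-SSQ3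
(`cells/n1011/skel/T-SSQ3.md`) = a KERNEL proof of the O5 cell's node T19a
`O5.SupersingularLocalClassUniqueThree`. This file: pure local algebra, TOOL theorems only — no
definition, no named fact, no `sorry`; nothing about any curve; nothing booked.

## What

The target of T19a is the statement that the `3`-division quartics `Ψ₃` of two curves generate the
same quartic extension of `ℚ₃`. Row T-SSQ3 proves that this extension is always the Kummer field
`K₄ = ℚ₃(ϖ)`, `ϖ⁴ = 3`, realised here as Mathlib's `AdjoinRoot (X ^ 4 - C 3)` over `ℚ_[3]` (written out in full below; no
notation or definition is introduced), by
producing roots of `Ψ₃` in `K₄` with HENSEL'S LEMMA in the order `𝓞₄ = ℤ₃[ϖ] = AdjoinRoot (X⁴ − 3)`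
over `ℤ_[3]`. This file supplies:

* `irreducible_kummerQuartic` — `X⁴ − 3` is irreducible over `ℚ₃` (Eisenstein at `3` over
  `ℤ₃` + Gauss), so `K₄` is a field; `finrank_kummerField : finrank ℚ_[3] K₄ = 4`; `root_pow_four : ϖ⁴ = 3`.
* `isAdicComplete_span_root` — `ℤ₃[ϖ]` is `(ϖ)`-adically complete: it is module-finite over the
  `3`-adically complete Noetherian ring `ℤ₃`, hence `(3)`-adically complete (Matsumura, Thm. 8.7, the
  tree's `Literature.AlgebraicGeometry.Resolution.isAdicComplete_map_of_finite`), and `(ϖ)⁴ = (3)`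
  (cofinal filtrations, `isAdicComplete_of_le_of_pow_le`). Hence `ℤ₃[ϖ]` is Henselian at `(ϖ)`
  (Mathlib `IsAdicComplete.henselianRing`).
* END `exists_root_quarticShape` — for `c₀, c₁, c₂, c₃ ∈ ℤ₃` with `3 ∣ c₀ + 1`, the quartic
  `z⁴ + c₃ϖ³z³ + c₂ϖ²z² + c₁ϖz + c₀ ≡ z⁴ − 1 (mod ϖ)` has a root in `K₄` (Hensel at `z = 1`: the value
  lies in `(ϖ)`, the derivative is `≡ 4`, a unit). This is the common shape of the two Hensel steps of
  row T-SSQ3 (reversed `Ψ₃` at a good supersingular `3`; `Ψ₃(3ϖz)/3⁶` at a `III*`).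
* END `exists_aeval_eq_zero_of_roots_in_kummerField` — an irreducible quartic `g` over `ℚ₃` with a root in
  `K₄` has `ℚ₃[X]/(g) ≅ K₄` (`bijective_liftAlgHom_of_natDegree_eq_four`: an injection of
  `4`-dimensional `ℚ₃`-spaces), so every polynomial with a root in `K₄` has a root in `ℚ₃[X]/(g)` —
  the shape of `O5.SameDivisionQuarticAtThree`.

References: H. Matsumura, *Commutative Ring Theory*, Thm. 8.7 [Matsumura1987]; J.-P. Serre, *Local
Fields* II §4 (Hensel) [folklore]; cells/n1011/skel/T-SSQ3.md.
-/

noncomputable section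

open Polynomial

namespace Summit.BirchSwinnertonDyer.Rank1Residual.GaloisImage.QuarticKummerThree

/-! ## §1 `X⁴ − 3` over `ℤ₃` and `ℚ₃` -/

/-- `X⁴ − 3 ∈ ℤ₃[X]` is monic. [folklore] -/
theorem monic_kummerQuarticInt : (X ^ 4 - C (3 : ℤ_[3]) : ℤ_[3][X]).Monic :=
  monic_X_pow_sub_C _ (by norm_num)

/-- `X⁴ − 3 ∈ ℤ₃[X]` has degree `4`. [folklore] -/
theorem natDegree_kummerQuarticInt : (X ^ 4 - C (3 : ℤ_[3]) : ℤ_[3][X]).natDegree = 4 :=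
  natDegree_X_pow_sub_C

/-- `X⁴ − 3 ∈ ℚ₃[X]` has degree `4`. [folklore] -/
theorem natDegree_kummerQuartic : (X ^ 4 - C (3 : ℚ_[3]) : ℚ_[3][X]).natDegree = 4 :=
  natDegree_X_pow_sub_C

/-- `X⁴ − 3 ∈ ℚ₃[X]` is the base change of `X⁴ − 3 ∈ ℤ₃[X]`. [folklore] -/
theorem map_kummerQuarticInt : (X ^ 4 - C (3 : ℤ_[3]) : ℤ_[3][X]).map (algebraMap ℤ_[3] ℚ_[3]) =
    (X ^ 4 - C (3 : ℚ_[3]) : ℚ_[3][X]) := by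
  rw [Polynomial.map_sub, Polynomial.map_pow, Polynomial.map_X, Polynomial.map_C, map_ofNat]

/-- `3` generates the maximal ideal of `ℤ₃` and is not in its square. [folklore] -/
theorem three_not_mem_maximalIdeal_sq :
    (3 : ℤ_[3]) ∉ (IsLocalRing.maximalIdeal ℤ_[3]) ^ 2 := by
  rw [PadicInt.maximalIdeal_eq_span_p, Ideal.span_singleton_pow, Ideal.mem_span_singleton]
  rintro ⟨c, hc⟩
  have h1 : ‖((3 : ℕ) : ℤ_[3]) ^ 2 * c‖ = ‖((3 : ℕ) : ℤ_[3])‖ := by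
    rw [← show ((3 : ℕ) : ℤ_[3]) = 3 from by norm_cast] at hc; rw [← hc]
  rw [norm_mul, norm_pow, PadicInt.norm_p] at h1
  have hc1 : ‖c‖ ≤ 1 := PadicInt.norm_le_one c
  have : (0 : ℝ) < 3 := by norm_num
  nlinarith [norm_nonneg c]

/-- `X⁴ − 3` is Eisenstein at `(3) = 𝔪_{ℤ₃}`. [folklore] -/
theorem isEisensteinAt_kummerQuarticInt :
    (X ^ 4 - C (3 : ℤ_[3]) : ℤ_[3][X]).IsEisensteinAt (IsLocalRing.maximalIdeal ℤ_[3]) := by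
  refine ⟨?_, fun {n} hn ↦ ?_, ?_⟩
  · rw [monic_kummerQuarticInt.leadingCoeff]
    exact (IsLocalRing.maximalIdeal.isMaximal ℤ_[3]).ne_top ∘
      (Ideal.eq_top_of_isUnit_mem _ · isUnit_one)
  · rw [natDegree_kummerQuarticInt] at hn
    rw [coeff_sub, coeff_X_pow, coeff_C]
    rcases Nat.lt_succ_iff_lt_or_eq.mp hn with hn | rfl
    · interval_cases n
      · simp only [show (0:ℕ) ≠ 4 by decide, if_false, if_true, zero_sub, neg_mem_iff]
        rw [PadicInt.maximalIdeal_eq_span_p, Ideal.mem_span_singleton]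
        exact ⟨1, by norm_num⟩
      all_goals simp
    · simp
  · rw [coeff_sub, coeff_X_pow, coeff_C]
    simp only [show (0:ℕ) ≠ 4 by decide, if_false, if_true, zero_sub, neg_mem_iff]
    exact three_not_mem_maximalIdeal_sq

/-- **`X⁴ − 3` is irreducible over `ℚ₃`** (Eisenstein at `3` over `ℤ₃`, Gauss's lemma). [folklore] -/
theorem irreducible_kummerQuartic : Irreducible (X ^ 4 - C (3 : ℚ_[3]) : ℚ_[3][X]) := by
  have hirr : Irreducible (X ^ 4 - C (3 : ℤ_[3]) : ℤ_[3][X]) :=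
    isEisensteinAt_kummerQuarticInt.irreducible (IsLocalRing.maximalIdeal.isMaximal ℤ_[3]).isPrime
      monic_kummerQuarticInt.isPrimitive (by rw [natDegree_kummerQuarticInt]; norm_num)
  rw [← map_kummerQuarticInt]
  exact (monic_kummerQuarticInt.irreducible_iff_irreducible_map_fraction_map (K := ℚ_[3])).mp hirr

/-- `X⁴ − 3 ≠ 0` in `ℚ₃[X]`. [folklore] -/
theorem kummerQuartic_ne_zero : (X ^ 4 - C (3 : ℚ_[3]) : ℚ_[3][X]) ≠ 0 :=
  (monic_X_pow_sub_C (3 : ℚ_[3]) (by norm_num)).ne_zero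

/-- **`[(AdjoinRoot (X ^ 4 - C (3 : ℚ_[3]))) : ℚ₃] = 4`.** [folklore] -/
theorem finrank_kummerField : Module.finrank ℚ_[3] (AdjoinRoot (X ^ 4 - C (3 : ℚ_[3]))) = 4 := by
  rw [(AdjoinRoot.powerBasis kummerQuartic_ne_zero).finrank, AdjoinRoot.powerBasis_dim, natDegree_kummerQuartic]

/-- `ϖ⁴ = 3` in `(AdjoinRoot (X ^ 4 - C (3 : ℚ_[3])))`. [folklore] -/
theorem root_pow_four : (AdjoinRoot.root (X ^ 4 - C (3 : ℚ_[3]))) ^ 4 = (3 : (AdjoinRoot (X ^ 4 - C (3 : ℚ_[3])))) := by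
  have h := AdjoinRoot.eval₂_root (X ^ 4 - C (3 : ℚ_[3]))
  rwa [eval₂_sub, eval₂_X_pow, eval₂_C, sub_eq_zero, map_ofNat] at h

/-- `ϖ⁴ = 3` in `(AdjoinRoot (X ^ 4 - C (3 : ℤ_[3]))) = ℤ₃[ϖ]`. [folklore] -/
theorem rootInt_pow_four : (AdjoinRoot.root (X ^ 4 - C (3 : ℤ_[3]))) ^ 4 = (3 : (AdjoinRoot (X ^ 4 - C (3 : ℤ_[3])))) := by
  have h := AdjoinRoot.eval₂_root (X ^ 4 - C (3 : ℤ_[3]))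
  rwa [eval₂_sub, eval₂_X_pow, eval₂_C, sub_eq_zero, map_ofNat] at h

/-! ## §2 `ℤ₃[ϖ]` is `(ϖ)`-adically complete, hence Henselian -/

/-- `(AdjoinRoot (X ^ 4 - C (3 : ℤ_[3]))) = ℤ₃[ϖ]` is a finite `ℤ₃`-module (power basis `1, ϖ, ϖ², ϖ³`). [folklore] -/
theorem moduleFinite_kummerOrder : Module.Finite ℤ_[3] (AdjoinRoot (X ^ 4 - C (3 : ℤ_[3]))) :=
  Module.Finite.of_basis (AdjoinRoot.powerBasis' monic_kummerQuarticInt).basis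

/-- **Cofinal filtrations give the same completeness**: if `J ≤ I` and `I ^ e ≤ J` (`e ≥ 1`), an
`R`-module that is `J`-adically complete is `I`-adically complete. [folklore] -/
theorem isAdicComplete_of_le_of_pow_le {R M : Type*} [CommRing R] [AddCommGroup M] [Module R M]
    {I J : Ideal R} (hJI : J ≤ I) {e : ℕ} (he : 0 < e) (hIJ : I ^ e ≤ J) [IsAdicComplete J M] :
    IsAdicComplete I M := by
  have hpow : ∀ n : ℕ, (I ^ (e * n) • ⊤ : Submodule R M) ≤ J ^ n • ⊤ := fun n ↦ by
    rw [pow_mul]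
    exact Submodule.smul_mono_left (Ideal.pow_right_mono hIJ n)
  have hpow' : ∀ n : ℕ, (J ^ n • ⊤ : Submodule R M) ≤ I ^ n • ⊤ := fun n ↦
    Submodule.smul_mono_left (Ideal.pow_right_mono hJI n)
  haveI h₁ : IsHausdorff I M := ⟨fun x hx ↦ by
    refine IsHausdorff.haus' (I := J) x fun n ↦ ?_
    have h := hx (e * n)
    rw [SModEq.zero] at h ⊢
    exact hpow n h⟩
  haveI h₂ : IsPrecomplete I M := ⟨fun f hf ↦ by
    -- the subsequence `n ↦ f (e * n)` is `J`-Cauchy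
    have hg : ∀ {m n : ℕ}, m ≤ n → f (e * m) ≡ f (e * n) [SMOD (J ^ m • ⊤ : Submodule R M)] := by
      intro m n hmn
      have h := hf (Nat.mul_le_mul_left e hmn)
      rw [SModEq.sub_mem] at h ⊢
      exact hpow m h
    obtain ⟨L, hL⟩ := IsPrecomplete.prec' (I := J) (f := fun n ↦ f (e * n)) fun {m n} hmn ↦ hg hmn
    refine ⟨L, fun n ↦ ?_⟩
    have h1 : f n ≡ f (e * n) [SMOD (I ^ n • ⊤ : Submodule R M)] :=
      hf (Nat.le_mul_of_pos_left n he)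
    have h2 : f (e * n) ≡ L [SMOD (I ^ n • ⊤ : Submodule R M)] := by
      have h := hL n
      rw [SModEq.sub_mem] at h ⊢
      exact hpow' n h
    exact h1.trans h2⟩
  exact { toIsHausdorff := h₁, toIsPrecomplete := h₂ }

/-- **`ℤ₃[ϖ]` is `(ϖ)`-adically complete**: it is `3ℤ₃[ϖ]`-adically complete (module-finite over
the complete Noetherian ring `ℤ₃`; Matsumura Thm. 8.7, the tree's `isAdicComplete_map_of_finite`)
and `(ϖ)⁴ = (3) ≤ (ϖ)`. [cite: Matsumura1987, Thm. 8.7] -/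
theorem isAdicComplete_span_root :
    IsAdicComplete (Ideal.span {AdjoinRoot.root (X ^ 4 - C (3 : ℤ_[3]))}) (AdjoinRoot (X ^ 4 - C (3 : ℤ_[3]))) := by
  haveI := moduleFinite_kummerOrder
  have h3 : IsAdicComplete ((IsLocalRing.maximalIdeal ℤ_[3]).map (algebraMap ℤ_[3] (AdjoinRoot (X ^ 4 - C (3 : ℤ_[3]))))) (AdjoinRoot (X ^ 4 - C (3 : ℤ_[3]))) :=
    Literature.AlgebraicGeometry.Resolution.isAdicComplete_map_of_finite ℤ_[3] (AdjoinRoot (X ^ 4 - C (3 : ℤ_[3])))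
      (IsLocalRing.maximalIdeal ℤ_[3])
  have hJ : (IsLocalRing.maximalIdeal ℤ_[3]).map (algebraMap ℤ_[3] (AdjoinRoot (X ^ 4 - C (3 : ℤ_[3])))) =
      Ideal.span {(3 : (AdjoinRoot (X ^ 4 - C (3 : ℤ_[3]))))} := by
    rw [PadicInt.maximalIdeal_eq_span_p, Ideal.map_span, Set.image_singleton, map_natCast,
      Nat.cast_ofNat]
  rw [hJ] at h3
  haveI := h3
  refine isAdicComplete_of_le_of_pow_le (J := Ideal.span {(3 : (AdjoinRoot (X ^ 4 - C (3 : ℤ_[3]))))}) ?_ (e := 4) (by norm_num) ?_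
  · rw [Ideal.span_singleton_le_iff_mem, Ideal.mem_span_singleton]
    exact ⟨AdjoinRoot.root (X ^ 4 - C (3 : ℤ_[3])) ^ 3, by rw [← rootInt_pow_four]; ring⟩
  · rw [Ideal.span_singleton_pow, rootInt_pow_four]

/-- **Hensel in `ℤ₃[ϖ]`**: the quartic `z⁴ + c₃ϖ³z³ + c₂ϖ²z² + c₁ϖz + c₀` with `cᵢ ∈ ℤ₃`,
`3 ∣ c₀ + 1` (so `≡ z⁴ − 1 (mod ϖ)`) has a root in `ℤ₃[ϖ]` congruent to `1` modulo `ϖ`.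
[folklore] -/
theorem exists_root_quarticShape_order (c₀ c₁ c₂ c₃ : ℤ_[3]) (h₀ : (3 : ℤ_[3]) ∣ c₀ + 1) :
    ∃ z : (AdjoinRoot (X ^ 4 - C (3 : ℤ_[3]))), z ^ 4 + AdjoinRoot.of (X ^ 4 - C (3 : ℤ_[3])) c₃ * AdjoinRoot.root (X ^ 4 - C (3 : ℤ_[3])) ^ 3 * z ^ 3 +
        AdjoinRoot.of (X ^ 4 - C (3 : ℤ_[3])) c₂ * AdjoinRoot.root (X ^ 4 - C (3 : ℤ_[3])) ^ 2 * z ^ 2 +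
        AdjoinRoot.of (X ^ 4 - C (3 : ℤ_[3])) c₁ * AdjoinRoot.root (X ^ 4 - C (3 : ℤ_[3])) * z + AdjoinRoot.of (X ^ 4 - C (3 : ℤ_[3])) c₀ = 0 ∧
      z - 1 ∈ Ideal.span {AdjoinRoot.root (X ^ 4 - C (3 : ℤ_[3]))} := by
  haveI := isAdicComplete_span_root
  set ϖ : (AdjoinRoot (X ^ 4 - C (3 : ℤ_[3]))) := AdjoinRoot.root (X ^ 4 - C (3 : ℤ_[3])) with hϖ
  set ι : ℤ_[3] →+* (AdjoinRoot (X ^ 4 - C (3 : ℤ_[3]))) := AdjoinRoot.of (X ^ 4 - C (3 : ℤ_[3])) with hι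
  set I : Ideal (AdjoinRoot (X ^ 4 - C (3 : ℤ_[3]))) := Ideal.span {ϖ} with hI
  obtain ⟨t, ht⟩ := h₀
  -- the monic quartic
  set H : (AdjoinRoot (X ^ 4 - C (3 : ℤ_[3])))[X] := X ^ 4 + C (ι c₃ * ϖ ^ 3) * X ^ 3 + C (ι c₂ * ϖ ^ 2) * X ^ 2 +
    C (ι c₁ * ϖ) * X + C (ι c₀) with hH
  have hHm : H.Monic := by
    rw [hH]; monicity!
  have hH1 : H.eval 1 ∈ I := by
    rw [hH, hI, Ideal.mem_span_singleton']
    refine ⟨ι t * ϖ ^ 3 + ι c₃ * ϖ ^ 2 + ι c₂ * ϖ + ι c₁, ?_⟩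
    simp only [eval_add, eval_mul, eval_pow, eval_X, eval_C, one_pow, mul_one]
    have h1 : ι c₀ = ι 3 * ι t - 1 := by
      rw [← map_mul, ← ht, map_add, map_one, add_sub_cancel_right]
    rw [h1, map_ofNat ι, ← rootInt_pow_four]
    ring
  have hH' : IsUnit (Ideal.Quotient.mk I (H.derivative.eval 1)) := by
    have hd : H.derivative.eval 1 =
        4 + ϖ * (3 * ι c₃ * ϖ ^ 2 + 2 * ι c₂ * ϖ + ι c₁) := by
      rw [hH]
      simp only [derivative_add, derivative_mul, derivative_X_pow, derivative_C, derivative_X,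
        zero_mul, zero_add, mul_one, eval_add, eval_mul, eval_pow, eval_X, eval_C, one_pow, mul_one,
        add_zero]
      push_cast
      ring
    have hmem : ϖ * (3 * ι c₃ * ϖ ^ 2 + 2 * ι c₂ * ϖ + ι c₁) ∈ I :=
      hI ▸ Ideal.mul_mem_right _ _ (Ideal.mem_span_singleton_self ϖ)
    rw [hd, map_add, (Ideal.Quotient.eq_zero_iff_mem).mpr hmem, add_zero]
    have h4ℤ : IsUnit (4 : ℤ_[3]) := by
      rw [PadicInt.isUnit_iff, ← show ((4 : ℕ) : ℤ_[3]) = 4 by norm_cast,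
        PadicInt.norm_natCast_eq_one_iff]
      decide
    have h4 : IsUnit (4 : (AdjoinRoot (X ^ 4 - C (3 : ℤ_[3])))) := by
      rw [← map_ofNat ι 4]; exact h4ℤ.map ι
    exact h4.map (Ideal.Quotient.mk I)
  obtain ⟨z, hz, hz1⟩ := HenselianRing.is_henselian (R := (AdjoinRoot (X ^ 4 - C (3 : ℤ_[3])))) (I := I) H hHm 1 hH1 hH'
  refine ⟨z, ?_, hz1⟩
  have h := hz.eq_zero
  rw [hH] at h
  simpa only [eval_add, eval_mul, eval_pow, eval_X, eval_C] using h

/-- The reduction map `ℤ₃[ϖ] → (AdjoinRoot (X ^ 4 - C (3 : ℚ_[3]))) = ℚ₃(ϖ)` (`ϖ ↦ ϖ`, `ℤ₃ ↪ ℚ₃`). [folklore] -/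
theorem eval₂_kummerQuarticInt_root_eq_zero :
    (X ^ 4 - C (3 : ℤ_[3]) : ℤ_[3][X]).eval₂ ((AdjoinRoot.of (X ^ 4 - C (3 : ℚ_[3]))).comp (algebraMap ℤ_[3] ℚ_[3]))
      (AdjoinRoot.root (X ^ 4 - C (3 : ℚ_[3]))) = 0 := by
  rw [eval₂_sub, eval₂_X_pow, eval₂_C, RingHom.comp_apply, map_ofNat (algebraMap ℤ_[3] ℚ_[3]) 3,
    map_ofNat (AdjoinRoot.of _) 3, root_pow_four, sub_self]

/-- **END (F1). A root in `(AdjoinRoot (X ^ 4 - C (3 : ℚ_[3])))` of the quartic shape of row T-SSQ3**: for `c₀, c₁, c₂, c₃ ∈ ℤ₃` with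
`3 ∣ c₀ + 1`, the quartic `ζ⁴ + c₃ϖ³ζ³ + c₂ϖ²ζ² + c₁ϖζ + c₀` has a root `ζ ∈ (AdjoinRoot (X ^ 4 - C (3 : ℚ_[3]))) = ℚ₃(ϖ)`, `ϖ⁴ = 3`
(Hensel in `ℤ₃[ϖ]`, then `ℤ₃[ϖ] → (AdjoinRoot (X ^ 4 - C (3 : ℚ_[3])))`). [folklore] -/
theorem exists_root_quarticShape (c₀ c₁ c₂ c₃ : ℤ_[3]) (h₀ : (3 : ℤ_[3]) ∣ c₀ + 1) :
    ∃ ζ : (AdjoinRoot (X ^ 4 - C (3 : ℚ_[3]))), ζ ^ 4 + AdjoinRoot.of (X ^ 4 - C (3 : ℚ_[3])) (c₃ : ℚ_[3]) * AdjoinRoot.root (X ^ 4 - C (3 : ℚ_[3])) ^ 3 * ζ ^ 3 +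
        AdjoinRoot.of (X ^ 4 - C (3 : ℚ_[3])) (c₂ : ℚ_[3]) * AdjoinRoot.root (X ^ 4 - C (3 : ℚ_[3])) ^ 2 * ζ ^ 2 +
        AdjoinRoot.of (X ^ 4 - C (3 : ℚ_[3])) (c₁ : ℚ_[3]) * AdjoinRoot.root (X ^ 4 - C (3 : ℚ_[3])) * ζ + AdjoinRoot.of (X ^ 4 - C (3 : ℚ_[3])) (c₀ : ℚ_[3]) = 0 := by
  obtain ⟨z, hz, -⟩ := exists_root_quarticShape_order c₀ c₁ c₂ c₃ h₀
  set ψ : (AdjoinRoot (X ^ 4 - C (3 : ℤ_[3]))) →+* (AdjoinRoot (X ^ 4 - C (3 : ℚ_[3]))) := AdjoinRoot.lift ((AdjoinRoot.of (X ^ 4 - C (3 : ℚ_[3]))).comp (algebraMap ℤ_[3] ℚ_[3]))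
    (AdjoinRoot.root (X ^ 4 - C (3 : ℚ_[3]))) eval₂_kummerQuarticInt_root_eq_zero with hψ
  refine ⟨ψ z, ?_⟩
  have h := congrArg ψ hz
  simp only [map_add, map_mul, map_pow, map_zero, hψ, AdjoinRoot.lift_root, AdjoinRoot.lift_of,
    RingHom.coe_comp, Function.comp_apply] at h
  simpa using h

/-! ## §3 Two quartics with roots in `(AdjoinRoot (X ^ 4 - C (3 : ℚ_[3])))` define the same extension -/

/-- `aeval` is `eval₂` along `Algebra.ofId` (the hypothesis shape of `AdjoinRoot.liftAlgHom`).
[folklore] -/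
theorem eval₂_ofId_eq_zero_of_aeval {g : ℚ_[3][X]} {x : (AdjoinRoot (X ^ 4 - C (3 : ℚ_[3])))} (hx : aeval x g = 0) :
    g.eval₂ (Algebra.ofId ℚ_[3] (AdjoinRoot (X ^ 4 - C (3 : ℚ_[3])))) x = 0 := by
  rw [Algebra.toRingHom_ofId, ← aeval_def]; exact hx

/-- **Any irreducible quartic over `ℚ₃` with a root in `(AdjoinRoot (X ^ 4 - C (3 : ℚ_[3])))` defines `(AdjoinRoot (X ^ 4 - C (3 : ℚ_[3])))`**: the `ℚ₃`-algebra map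
`ℚ₃[X]/(g) → (AdjoinRoot (X ^ 4 - C (3 : ℚ_[3])))`, `X ↦ x`, is an injection between `ℚ₃`-spaces of dimension `4`, hence an
isomorphism. [folklore] -/
theorem bijective_liftAlgHom_of_natDegree_eq_four {g : ℚ_[3][X]} (hg : Irreducible g)
    (hdeg : g.natDegree = 4) {x : (AdjoinRoot (X ^ 4 - C (3 : ℚ_[3])))} (hx : aeval x g = 0) :
    Function.Bijective
      (AdjoinRoot.liftAlgHom g (Algebra.ofId ℚ_[3] (AdjoinRoot (X ^ 4 - C (3 : ℚ_[3])))) x (eval₂_ofId_eq_zero_of_aeval hx)) := by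
  haveI : Fact (Irreducible g) := ⟨hg⟩
  haveI : Fact (Irreducible (X ^ 4 - C (3 : ℚ_[3]))) := ⟨irreducible_kummerQuartic⟩
  haveI : Module.Finite ℚ_[3] (AdjoinRoot g) := (AdjoinRoot.powerBasis hg.ne_zero).finite
  haveI : Module.Finite ℚ_[3] (AdjoinRoot (X ^ 4 - C (3 : ℚ_[3]))) := (AdjoinRoot.powerBasis kummerQuartic_ne_zero).finite
  set φ := AdjoinRoot.liftAlgHom g (Algebra.ofId ℚ_[3] (AdjoinRoot (X ^ 4 - C (3 : ℚ_[3])))) x (eval₂_ofId_eq_zero_of_aeval hx)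
    with hφ
  have hinj : Function.Injective φ := φ.toRingHom.injective
  refine ⟨hinj, ?_⟩
  have hrank : Module.finrank ℚ_[3] (AdjoinRoot g) = Module.finrank ℚ_[3] (AdjoinRoot (X ^ 4 - C (3 : ℚ_[3]))) := by
    rw [finrank_kummerField, (AdjoinRoot.powerBasis hg.ne_zero).finrank, AdjoinRoot.powerBasis_dim, hdeg]
  exact (LinearMap.injective_iff_surjective_of_finrank_eq_finrank hrank
    (f := φ.toLinearMap)).mp hinj

/-- **END (F1, algebra). Two quartics with roots in `(AdjoinRoot (X ^ 4 - C (3 : ℚ_[3])))` generate the same field**: if `g` is an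
irreducible quartic over `ℚ₃` with a root in `(AdjoinRoot (X ^ 4 - C (3 : ℚ_[3])))` and `g'` is any polynomial with a root in `(AdjoinRoot (X ^ 4 - C (3 : ℚ_[3])))`, then
`g'` has a root in `ℚ₃[X]/(g)`. [folklore] -/
theorem exists_aeval_eq_zero_of_roots_in_kummerField {g g' : ℚ_[3][X]} (hg : Irreducible g)
    (hdeg : g.natDegree = 4) {x x' : (AdjoinRoot (X ^ 4 - C (3 : ℚ_[3])))} (hx : aeval x g = 0) (hx' : aeval x' g' = 0) :
    ∃ θ : AdjoinRoot g, aeval θ g' = 0 := by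
  set e := AlgEquiv.ofBijective
    (AdjoinRoot.liftAlgHom g (Algebra.ofId ℚ_[3] (AdjoinRoot (X ^ 4 - C (3 : ℚ_[3])))) x (eval₂_ofId_eq_zero_of_aeval hx))
    (bijective_liftAlgHom_of_natDegree_eq_four hg hdeg hx) with he
  refine ⟨e.symm x', ?_⟩
  rw [aeval_algEquiv, AlgHom.coe_comp, Function.comp_apply, hx', map_zero]

end Summit.BirchSwinnertonDyer.Rank1Residual.GaloisImage.QuarticKummerThree

end
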